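import Literature.MathematicalPhysics.QuantumFieldTheory.Balaban1983to89.B9Eq368TowerProjLadderClosed
import Literature.MathematicalPhysics.QuantumFieldTheory.Balaban1983to89.B9Thm34TowerVacuumLadderGradient

/-!
# `Balaban1983to89.B9Eq368TowerProjGradientLadder` — T. Bałaban, *Propagators for lattice gauge theories in a background field*, Commun. Math. Phys. **99** (1985) 389–434
# [Balaban1985BackgroundPropagators] (3.68) p. 403 (*«R(U), P(U) = I − R(U) … satisfy the same bounds»* — «the same» = Thm 3.1's, which include the GRADIENT row (3.42)₂), (3.25) p. 394,
# Thm 3.2 (3.48) p. 398, Thm 3.11 p. 416, with [Balaban1984PropagatorsII] (2.51)–(2.55) p. 232, (2.66) p. 234: **THE TWO-BACKGROUND LADDER FOR THE GRADIENT ROW OF THE NE9 CHAIN's `k`-LEVEL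
# PROJECTION `R_k(U)`** — for every flat direction letter `∇^η_{1,k}`: `conj b (∇^η_{1,k}) * (conj b (readA φ R_k(U)) − conj b (readA φ R_k(1))) ≺ K·α·e^{−δ d}` over `towerGeom`, constants BEFORE
# `n, η, m, U` — gen 99's `B9Eq368TowerProjLadder` with its first propagator factor read through the GRADIENT ladder `B9Thm34TowerVacuumLadderGradient` (this gen) instead of the value ladder:
# by (3.25) `R_k = 1 − G′_kS c_k A G′_k`, so `∇_1(R_k(U) − R_k(1)) = −[(∇_1G′_k(U))S_Uc_UA_UG′_k(U) − (∇_1G′_k(1))S_1c_1A_1G′_k(1)]` (the `∇_1·1` terms CANCEL), a five-factor telescoping with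
# a DISTINCT first pair; §2 GIVEN the `c_k` rows ∕ ladder, §3 with them CLOSED (`B9Eq367TowerQGGQInvLadderClosed`, the OWNER's `exists_local_letter_QGGQInvk_closed`)

statement-level skeleton of published theorems with citation tags; proofs where landed; nothing here is a claim about the Yang–Mills mass gap

CITATION HEADER (lean-in-tree rule).  Audit cell `pub-balaban`, sub-cell `t4`, BINDER row NE9; NE9 crux-team LEAF PROVER 01 (`b2b-balaban-t4-ne9-formalise-leaf-01`, gen 100;
bears_on: R4/N22).  Composition BY NAME, nothing restated: gen 99's `B9Eq368TowerProjLadder.conj_readA_RofUk_eq` ((3.25) read ∕ realified), `B9Eq368TowerFiveFactorWordLadder.hasMajorant_word5`,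
`B9Eq365TowerXOperatorLadder` (block-diagonal letters), `B9Eq358TowerKernelSizes` (their sizes), `B9Eq342TowerFlatBaseMajorants` (Thm-3.1 rows at the vacuum, the gradient row (3.42)₂ included),
`B9Thm34TowerVacuumLadder` (value ladder, last factor) and this gen's `B9Thm34TowerVacuumLadderGradient` (gradient ladder, first factor); §3 by `B9Eq367TowerQGGQInvLadderClosed` +
`B9Eq349TowerSiteRowSeam` + the OWNER's `B9Eq326WoodburyLettersTower.exists_local_letter_QGGQInvk_closed`, exactly as `B9Eq368TowerProjLadderClosed` (whose proof text §2–§3 re-run).  Sources: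
[Balaban1985BackgroundPropagators] pp. 394, 397–398, 403 (text layer pp. 6, 9–10, 15 read by this lineage 2026-08-28).  Print's (3.68) is asserted there without proof («satisfy the same bounds»);
the cell's road is the telescoping above; NOTHING else of print is reproduced.

WHAT IS PROVED (sorry-free; proof lane — no `def`).
* §1 [folklore∕[4] (2.66)] `hasMajorant_word5_sub_word5_first` — the five-factor two-background telescoping of `B9Eq368TowerFiveFactorWordLadder` with a first factor pair `(P_U, P_1)` DISTINCT from
  the last pair `(E, F)`.
* §2 **`exists_hasMajorant_diffLetter_RofUk_sub_flat`** — GIVEN the coarse rows `K_c e^{−δ_c d}` of `c_k(U)`, `c_k(1)` and their ladder `K_D α e^{−δ_D d}`: `∃ α_R K δ > 0` BEFORE the lattice,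
  `∀ k`, `conj b (∇^η_{1,k}) * (conj b (readA φ R_k(U)) − conj b (readA φ R_k(1))) ≺ K·α·e^{−δ d}` on print's small-field class.
* §3 **`exists_hasMajorant_diffLetter_RofUk_sub_flat_closed`** — the same with the `c_k` data DISCHARGED (class of `B9Eq368TowerProjLadderClosed`).
HONEST SCOPE.  Composition BY NAME; constants crude (NOT print's); the Thm-3.1∕3.2 inputs are the cell's MODEL rows («NE9 ⇐ the named binders»; O-NE9-1 #5 UNRULED); the derivative is the FLAT one
(left letter only; the adjoint row `(R_k(U) − R_k(1))∇*` is NOT here, cf. `B9Thm34TowerVacuumLadderGradient`'s scope note); NE9 NOT PRINTED ∕ NOT PROVED; spine PROVED 0∕9; rung (B)+1 finite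
T⁴ — NOT infinite volume, NOT mass gap, NOT BetaPertH, NOT Clay.  HONEST DEPENDENCY: continuum YM on T⁴ ⇐ BetaPertH ∧ nine spine estimates (0/9 proved); BetaPertH ⇐ (D1) ∧ (D4) ∧ CAP+tail;
G-an2-4 gates asym, D1 and NE2/3/4.  NEW file; nothing modified.  Net new unproved facts: 0.
-/

noncomputable section

open scoped BigOperators InnerProductSpace

namespace Literature.MathematicalPhysics.QuantumFieldTheory.Balaban1983to89.B9Eq368TowerProjGradientLadder

open B4Sect5Torus (TSite)
open B7Prop1Explicit (U1)
open B9SectCLatticeCarrier (Bond shift)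
open B9Eq311L2Pairing (WL2)
open B11Eq103H1Complex (SiteL2K greenK)
open B9Eq310HessianOperator (adTransportW)
open B9Eq310HessianHermitian (adTransportW_adjoint)
open B9Eq315QTower (towerP UlevOf)
open B9Eq326OperatorTower (QprimeTowerW RofUk)
open B9Eq33CovDerivVector (adTransport)
open B9Eq324DeltaPrimeATower (laplacePrimeAk GpOfUk)
open B9Eq325ProjFormulaTower (QGGQk_pos RofUk_eq_formula)
open B6RandomWalk (HasMajorant hasMajorant_mono hasMajorant_add majorant_G0_mul_265 c1_nonneg)
open B6RandomWalkHom (HasMajorantHom hasMajorantHom_mono)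
open B6DomainMajorant (hasMajorant_neg)
open B4Sect5Proof (weaken)
open B9Thm34Ext (toB6)
open B9Eq352DivFormLetters (conj conj_sub)
open B9Eq376POneLetters (conjHom conjHom_sub conjHom_comp conjHom_eq_conj)
open B9Eq360Vprime (kerOp liftOp liftOp_apply)
open B9Eq357QprimeTowerKernelForm (blkK kQ norm_kQ_le kerOp_add_kernel)
open B9Eq324PenaltyKernelForm (sQ readA readA_sub readA_id norm_sQ_le)
open B9Eq358TowerKernelSizes (kQ_flatLevels_eq norm_kF_le_of_class norm_sF_le_of_class exp_window_sub_one_le)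
open B9Eq360LaplacePrimeAkLaw (conj_one)
open B9Eq341TowerBlockGeometry (towerGeom len_towerGeom hdnn_towerGeom)
open B9Eq342TowerFlatBaseMajorants (exists_hasMajorants_GpOfUk_one norm_adTransportW_UlevOf_one_le star_one_eq_inv_one)
open B9Thm34TowerVacuumLadder (exists_hasMajorant_GpOfUk_sub_flat)
open B9Eq319QprimeTowerHomMajorants (readAHom readAHom_Qtilde_eq_kerOp readAHom_adjoint_Qtilde_eq_liftOp)
open B9Eq365TowerXOperatorLadder (hasMajorantHom_kerOp_ind hasMajorantHom_liftOp_ind)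
open B9Eq365TowerQGGQWordLadder (readAHom_comp readAHom_eq_readA)
open B9Eq368TowerFiveFactorWordLadder (hasMajorant_word5)
open B9Eq368TowerProjLadder (conj_readA_RofUk_eq)
open B9Thm34TowerVacuumLadderGradient (exists_hasMajorant_diffLetter_GpOfUk_sub_flat)
open B9Eq33CovDerivVector (shiftEquiv)
open B9Eq352GradLetters (diffLetter)
open B9Eq310DeltaPrime (plaqHolU plaqHolU_one)
open B9Eq315QTorus (perCfg cornerSite)
open B9Eq315QTowerFlat (perCfg_UlevOf_one_mem_U1 norm_Wcx_UlevOf_one_sub_one_le)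
open B9Eq342TowerFlatBaseMajorants (UlevOf_one_norm_sub_one_le UlevOf_one_mem_U1)
open B9Eq326WoodburyLettersTower (exists_local_letter_QGGQInvk_closed)
open B9Eq349TowerSiteRowSeam (hasMajorant_conj_readA_of_siteRow_tdist)
open B9Eq367TowerQGGQInvLadderClosed (exists_hasMajorant_greenK_QGGQk_sub_flat)
open B7Prop1Explicit (Wcx boxVec)


/-! ## §1 The five-factor telescoping with a distinct first pair -/

section Abstract

variable {d : ℕ} (L : ℕ) (m : Fin d → ℕ) [∀ i, NeZero (m i)] (n : ℕ) (η M Rr : ℝ) (H : Prop)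
  {X Y : Type} (blkX : X → TSite d m) (blkY : Y → TSite d m)

/-- **THE TWO-BACKGROUND LADDER OF THE FIVE-FACTOR WORD WITH A DISTINCT FIRST PAIR**: with `P_1 ≺ B_PF e^{−δd}`, `P_U − P_1 ≺ B_PD·α·e^{−δd}` (first), `F ≺ B_F e^{−δd}`, `E − F ≺ B_D·α·e^{−δd}` (last); `S_U, S_1 ≺ 𝟙·s_S`, `S_U − S_1 ≺ 𝟙·s_D·α`; `c_U, c_1 ≺ K_c e^{−δd}`,
`c_U − c_1 ≺ K_D·α·e^{−δd}`; `A_U, A_1 ≺ 𝟙·a_S`, `A_U − A_1 ≺ 𝟙·a_D·α` (all constants `≥ 0`, `0 ≤ α ≤ α₀`, `δ > 0`):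
`P_U S_U c_U A_U E − P_1 S_1 c_1 A_1 F ≺ K·α·e^{−(δ∕2)d}`, `K = c₁²·[B_PD s_S K_c a_S B_E + B_PF s_D K_c a_S B_E + B_PF s_S K_D a_S B_E + B_PF s_S K_c a_D B_E + B_PF s_S K_c a_S B_D]`, `B_E = B_F + B_Dα₀` — `B9Eq368TowerFiveFactorWordLadder.hasMajorant_word5_sub_word5` is the case `P = E`.
[cite: Balaban1985BackgroundPropagators, (3.25) p.394, (3.68) p.403, Thm 3.1 (3.42) p.397, Thm 3.2 (3.48) p.398; Balaban1984PropagatorsII, (2.52)–(2.55) p.232, (2.66) p.234] -/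
theorem hasMajorant_word5_sub_word5_first {P Pf E F : Module.End ℝ (X → ℝ)} {SU S1 : (Y → ℝ) →ₗ[ℝ] (X → ℝ)} {cU c1 : Module.End ℝ (Y → ℝ)} {AU A1 : (X → ℝ) →ₗ[ℝ] (Y → ℝ)}
    {BPF BPD BF BD sS sD Kc KD aS aD α α₀ δ : ℝ} (hBPF : 0 ≤ BPF) (hBPD : 0 ≤ BPD) (hBF : 0 ≤ BF) (hBD : 0 ≤ BD) (hsS : 0 ≤ sS) (hsD : 0 ≤ sD) (hKc : 0 ≤ Kc) (hKD : 0 ≤ KD) (haS : 0 ≤ aS) (haD : 0 ≤ aD)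
    (hα : 0 ≤ α) (hαα : α ≤ α₀) (hδ : 0 < δ)
    (hPf : HasMajorant (g := toB6 (towerGeom L m n η M) Rr H) blkX Pf (fun a b => BPF * Real.exp (-(δ * (towerGeom L m n η M).dist a b))))
    (hPEF : HasMajorant (g := toB6 (towerGeom L m n η M) Rr H) blkX (P - Pf) (fun a b => BPD * α * Real.exp (-(δ * (towerGeom L m n η M).dist a b))))
    (hF : HasMajorant (g := toB6 (towerGeom L m n η M) Rr H) blkX F (fun a b => BF * Real.exp (-(δ * (towerGeom L m n η M).dist a b))))
    (hEF : HasMajorant (g := toB6 (towerGeom L m n η M) Rr H) blkX (E - F) (fun a b => BD * α * Real.exp (-(δ * (towerGeom L m n η M).dist a b))))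
    (hSU : HasMajorantHom (g := toB6 (towerGeom L m n η M) Rr H) blkY blkX SU (fun a b : TSite d m => if a = b then sS else 0))
    (hS1 : HasMajorantHom (g := toB6 (towerGeom L m n η M) Rr H) blkY blkX S1 (fun a b : TSite d m => if a = b then sS else 0))
    (hS : HasMajorantHom (g := toB6 (towerGeom L m n η M) Rr H) blkY blkX (SU - S1) (fun a b : TSite d m => if a = b then sD * α else 0))
    (hcU : HasMajorant (g := toB6 (towerGeom L m n η M) Rr H) blkY cU (fun a b => Kc * Real.exp (-(δ * (towerGeom L m n η M).dist a b))))
    (hc1 : HasMajorant (g := toB6 (towerGeom L m n η M) Rr H) blkY c1 (fun a b => Kc * Real.exp (-(δ * (towerGeom L m n η M).dist a b))))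
    (hc : HasMajorant (g := toB6 (towerGeom L m n η M) Rr H) blkY (cU - c1) (fun a b => KD * α * Real.exp (-(δ * (towerGeom L m n η M).dist a b))))
    (hAU : HasMajorantHom (g := toB6 (towerGeom L m n η M) Rr H) blkX blkY AU (fun a b : TSite d m => if a = b then aS else 0))
    (hA1 : HasMajorantHom (g := toB6 (towerGeom L m n η M) Rr H) blkX blkY A1 (fun a b : TSite d m => if a = b then aS else 0))
    (hA : HasMajorantHom (g := toB6 (towerGeom L m n η M) Rr H) blkX blkY (AU - A1) (fun a b : TSite d m => if a = b then aD * α else 0)) :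
    HasMajorant (g := toB6 (towerGeom L m n η M) Rr H) blkX
      (P ∘ₗ (SU ∘ₗ (cU ∘ₗ (AU ∘ₗ E))) - Pf ∘ₗ (S1 ∘ₗ (c1 ∘ₗ (A1 ∘ₗ F))))
      (fun a b => (B6.c1 d δ (1 / 2) * B6.c1 d δ (1 / 2) *
          (BPD * sS * Kc * aS * (BF + BD * α₀) + BPF * sD * Kc * aS * (BF + BD * α₀) + BPF * sS * KD * aS * (BF + BD * α₀) +
            BPF * sS * Kc * aD * (BF + BD * α₀) + BPF * sS * Kc * aS * BD)) * α *
        Real.exp (-(δ / 2 * (towerGeom L m n η M).dist a b))) := by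
  have hc1h : 0 ≤ B6.c1 d δ (1 / 2) := c1_nonneg d _ _
  have hBE : 0 ≤ BF + BD * α₀ := by nlinarith
  -- `E = F + (E − F) ≺ (B_F + B_Dα₀) e^{−δd}`
  have hE : HasMajorant (g := toB6 (towerGeom L m n η M) Rr H) blkX E (fun a b => (BF + BD * α₀) * Real.exp (-(δ * (towerGeom L m n η M).dist a b))) := by
    have h := hasMajorant_add _ hF hEF
    rw [add_sub_cancel] at h
    refine hasMajorant_mono _ h fun a b => ?_
    have hex := Real.exp_nonneg (-(δ * (towerGeom L m n η M).dist a b))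
    nlinarith [mul_le_mul_of_nonneg_left hαα hBD]
  -- the telescoping
  have hsplit : P ∘ₗ (SU ∘ₗ (cU ∘ₗ (AU ∘ₗ E))) - Pf ∘ₗ (S1 ∘ₗ (c1 ∘ₗ (A1 ∘ₗ F))) =
      (P - Pf) ∘ₗ (SU ∘ₗ (cU ∘ₗ (AU ∘ₗ E))) + (Pf ∘ₗ ((SU - S1) ∘ₗ (cU ∘ₗ (AU ∘ₗ E))) + (Pf ∘ₗ (S1 ∘ₗ ((cU - c1) ∘ₗ (AU ∘ₗ E))) +
        (Pf ∘ₗ (S1 ∘ₗ (c1 ∘ₗ ((AU - A1) ∘ₗ E))) + Pf ∘ₗ (S1 ∘ₗ (c1 ∘ₗ (A1 ∘ₗ (E - F))))))) := by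
    simp only [LinearMap.comp_sub, LinearMap.sub_comp]; abel
  rw [hsplit]
  have hT1 := hasMajorant_word5 L m n η M Rr H blkX blkY (mul_nonneg hBPD hα) hsS hKc haS hBE hδ hPEF hSU hcU hAU hE
  have hT2 := hasMajorant_word5 L m n η M Rr H blkX blkY hBPF (mul_nonneg hsD hα) hKc haS hBE hδ hPf hS hcU hAU hE
  have hT3 := hasMajorant_word5 L m n η M Rr H blkX blkY hBPF hsS (mul_nonneg hKD hα) haS hBE hδ hPf hS1 hc hAU hE
  have hT4 := hasMajorant_word5 L m n η M Rr H blkX blkY hBPF hsS hKc (mul_nonneg haD hα) hBE hδ hPf hS1 hc1 hA hE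
  have hT5 := hasMajorant_word5 L m n η M Rr H blkX blkY hBPF hsS hKc haS (mul_nonneg hBD hα) hδ hPf hS1 hc1 hA1 hEF
  refine hasMajorant_mono _ (hasMajorant_add _ hT1 (hasMajorant_add _ hT2 (hasMajorant_add _ hT3 (hasMajorant_add _ hT4 hT5)))) fun a b => le_of_eq ?_
  show _ = _
  rw [show δ / 2 = (1 - 1 / 2) * δ by ring]
  ring

end Abstract

/-! ## §2 The gradient ladder for `R_k`, given the `c_k` data -/

section Main

variable {d : ℕ} (L : ℕ) [NeZero L] {𝔸 : Type*} [NormedRing 𝔸] [NormedAlgebra ℂ 𝔸] [CompleteSpace 𝔸] [NormOneClass 𝔸] [StarRing 𝔸] [FiniteDimensional ℂ 𝔸]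
  {W : Type*} [NormedAddCommGroup W] [InnerProductSpace ℂ W] [FiniteDimensional ℂ W] (φ : W ≃ₗ[ℂ] 𝔸) {a' Mφ Mφ' : ℝ}
  (hMφ : 0 ≤ Mφ) (hMφ' : 0 ≤ Mφ') (hφn : ∀ w, ‖φ w‖ ≤ Mφ * ‖w‖) (hφn' : ∀ X, ‖φ.symm X‖ ≤ Mφ' * ‖X‖) (ha' : 0 < a')
  {r : ℝ} (hr0 : 0 ≤ r) (hr1 : r < 1)
  (τ : 𝔸 →ₗ[ℂ] ℂ) (hτ₂ : ∀ X Y : 𝔸, τ (X * Y) = τ (Y * X)) (hφτ : ∀ X Y : 𝔸, ⟪φ.symm X, φ.symm Y⟫_ℂ = τ (star X * Y))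
  {ι : Type} [Fintype ι] [DecidableEq ι] (b : Module.Basis ι ℝ 𝔸) {M₂ : ℝ} (hM₂ : 0 ≤ M₂) (hrepr : ∀ (v : 𝔸) (i : ι), |b.repr v i| ≤ M₂ * ‖v‖)

/-- `X * (P ∘ R) = (X * P) ∘ R` on `Module.End` (definitional). [folklore] -/
private theorem mul_comp_eq {V : Type*} [AddCommGroup V] [Module ℝ V] (X P R : Module.End ℝ V) :
    X * (P ∘ₗ R) = (X * P) ∘ₗ R := rfl

include hMφ hMφ' hφn hφn' ha' hr0 hr1 hτ₂ hφτ hM₂ hrepr in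
/-- **THE TWO-BACKGROUND LADDER FOR THE GRADIENT ROW OF `R_k`, GIVEN THE INVERSE THIRD OPERATOR's ROWS AND LADDER** (see the module docstring): for every flat direction letter `k`,
`conj b (∇^η_{1,k}) * (conj b (readA φ R_k(U)) − conj b (readA φ R_k(1))) ≺ K·α·e^{−δ d}`, constants BEFORE `n, η, m, U`.
[cite: Balaban1985BackgroundPropagators, (3.68) p.403, (3.25) p.394, Thm 3.1 (3.42) p.397, Thm 3.2 (3.48) p.398; Balaban1984PropagatorsII, (2.51)–(2.55) p.232, (2.66) p.234] -/
theorem exists_hasMajorant_diffLetter_RofUk_sub_flat (hd : 1 ≤ d) (hL3 : 3 ≤ L) {Kc δc KD δD : ℝ} (hKc : 0 ≤ Kc) (hδc : 0 < δc) (hKD : 0 ≤ KD) (hδD : 0 < δD) :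
    ∃ αR K δ : ℝ, 0 < αR ∧ 0 ≤ K ∧ 0 < δ ∧
      ∀ (n : ℕ) (η : ℝ), η * (L : ℝ) ^ (n + 1) = 1 →
      ∀ (c₀ c₁ : ℝ) [Fact (0 < c₀)] [Fact (0 < c₁)], c₀ * ((L : ℝ) ^ (n + 1)) ^ d = c₁ →
      ∀ (m : Fin d → ℕ) [∀ i, NeZero (m i)] (U : Bond d (towerP L m (n + 1)) → 𝔸ˣ) (α : ℝ), 0 ≤ α → α ≤ αR →
        (∀ bd, U bd ∈ U1 𝔸) → (∀ bd, ‖(U bd : 𝔸) - 1‖ ≤ α * η) →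
        (∀ (x : TSite d (towerP L m (n + 1))) (μ ν : Fin d), ‖(U (shift ν x, μ) : 𝔸) - (U (x, μ) : 𝔸)‖ ≤ α * η ^ 2) →
      ∀ (hUst : ∀ bd, star (U bd : 𝔸) = (((U bd)⁻¹ : 𝔸ˣ) : 𝔸))
        (εU : ℕ → ℝ), (∀ j, 0 ≤ εU j) → (∀ j, εU j ≤ 1) → (∀ j < n + 1, εU j ≤ α * r ^ j) →
        (∀ (j : ℕ) (bd : Bond d (towerP L m (j + 1))), ‖(UlevOf L m (n + 1) U j bd : 𝔸) - 1‖ ≤ εU j) →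
        (∀ (j : ℕ) (bd : Bond d (towerP L m (j + 1))), UlevOf L m (n + 1) U j bd ∈ U1 𝔸) →
        (∀ (j : ℕ) (bd : Bond d (towerP L m (j + 1))) (w : W), ‖adTransportW φ (UlevOf L m (n + 1) U j) bd w‖ ≤ ‖w‖) →
      ∀ (hposU : ∀ x : SiteL2K ℂ d (towerP L m (n + 1)) c₀ W, x ≠ 0 → 0 < RCLike.re ⟪x, laplacePrimeAk L m n φ η U a' (c₁ := c₁) x⟫_ℂ)
        (hpos₁ : ∀ x : SiteL2K ℂ d (towerP L m (n + 1)) c₀ W, x ≠ 0 →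
          0 < RCLike.re ⟪x, laplacePrimeAk L m n φ η (fun _ : Bond d (towerP L m (n + 1)) => (1 : 𝔸ˣ)) a' (c₁ := c₁) x⟫_ℂ)
        (M Rr : ℝ) (H : Prop) (k : Fin d ⊕ Fin d),
        HasMajorant (g := toB6 (towerGeom L m n η M) Rr H) (fun q : TSite d m × ι => q.1) (conj b (readA φ (greenK _ (QGGQk_pos L m n φ c₀ η U c₁ a' (adTransportW_adjoint φ τ hτ₂ hUst hφτ) hposU)))) (fun a a'' => Kc * Real.exp (-(δc * (towerGeom L m n η M).dist a a''))) →
        HasMajorant (g := toB6 (towerGeom L m n η M) Rr H) (fun q : TSite d m × ι => q.1) (conj b (readA φ (greenK _ (QGGQk_pos L m n φ c₀ η (fun _ : Bond d (towerP L m (n + 1)) => (1 : 𝔸ˣ)) c₁ a' (adTransportW_adjoint φ τ hτ₂ (star_one_eq_inv_one L m n) hφτ) hpos₁)))) (fun a a'' => Kc * Real.exp (-(δc * (towerGeom L m n η M).dist a a''))) →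
        HasMajorant (g := toB6 (towerGeom L m n η M) Rr H) (fun q : TSite d m × ι => q.1) (conj b (readA φ (greenK _ (QGGQk_pos L m n φ c₀ η U c₁ a' (adTransportW_adjoint φ τ hτ₂ hUst hφτ) hposU))) - conj b (readA φ (greenK _ (QGGQk_pos L m n φ c₀ η (fun _ : Bond d (towerP L m (n + 1)) => (1 : 𝔸ˣ)) c₁ a' (adTransportW_adjoint φ τ hτ₂ (star_one_eq_inv_one L m n) hφτ) hpos₁))))
          (fun a a'' => KD * α * Real.exp (-(δD * (towerGeom L m n η M).dist a a''))) →
      HasMajorant (g := toB6 (towerGeom L m n η M) Rr H) (fun p : TSite d (towerP L m (n + 1)) × ι => blkK L m n p.1)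
        (conj b (diffLetter (fun μ => shiftEquiv (Pd := towerP L m (n + 1)) μ)
            (fun μ y => (fun _ : Bond d (towerP L m (n + 1)) => (1 : 𝔸ˣ)) (y, μ)) ((η : ℂ))⁻¹ k) *
          (conj b (readA φ (RofUk L m n φ η U (c₀ := c₀))) - conj b (readA φ (RofUk L m n φ η (fun _ : Bond d (towerP L m (n + 1)) => (1 : 𝔸ˣ)) (c₀ := c₀)))))
        (fun a a'' => K * α * Real.exp (-(δ * (towerGeom L m n η M).dist a a''))) := by
  obtain ⟨αJ, BJ, δJ, hαJ, hBJ, hδJ, Hlad⟩ :=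
    exists_hasMajorant_GpOfUk_sub_flat L φ hMφ hMφ' hφn hφn' ha' hr0 hr1 τ hτ₂ hφτ b hM₂ hrepr hd hL3
  obtain ⟨αJ', BJ', δJ', hαJ'0, hBJ', hδJ'0, Hgrad⟩ :=
    exists_hasMajorant_diffLetter_GpOfUk_sub_flat L φ hMφ hMφ' hφn hφn' ha' hr0 hr1 τ hτ₂ hφτ b hM₂ hrepr hd hL3
  obtain ⟨BG, δ₀, hBG, hδ₀, hbase⟩ := exists_hasMajorants_GpOfUk_one L φ (a' := a') hMφ hMφ' hφn hφn' ha' τ hτ₂ hφτ b hM₂ hrepr hd hL3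
  -- the lattice-free constants
  have hSb : 0 ≤ ∑ i, ‖b i‖ := Finset.sum_nonneg fun i _ => norm_nonneg _
  set κ : ℝ := M₂ * ∑ i, ‖b i‖ with hκ
  have hκ0 : 0 ≤ κ := mul_nonneg hM₂ hSb
  set ck : ℝ := ((d * (L - 1) : ℕ) : ℝ) * (3 / (1 - r)) with hck
  have hck0 : 0 ≤ ck := mul_nonneg (Nat.cast_nonneg _) (div_nonneg (by norm_num) (by linarith))
  set cs : ℝ := ((d * (L - 1) : ℕ) : ℝ) * (2 * Mφ * Mφ' / (1 - r)) with hcs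
  have hcs0 : 0 ≤ cs := mul_nonneg (Nat.cast_nonneg _) (div_nonneg (by positivity) (by linarith))
  set cKF : ℝ := ck * Real.exp (ck * (1 / 16)) with hcKF
  set cSF : ℝ := Mφ * Mφ' * (cs * Real.exp (cs * (1 / 16))) with hcSF
  have hcKF0 : 0 ≤ cKF := by rw [hcKF]; positivity
  have hcSF0 : 0 ≤ cSF := by rw [hcSF]; positivity
  set δm : ℝ := min (min (min δ₀ δJ) δJ') (min δc δD) with hδm
  have hδm0 : 0 < δm := lt_min (lt_min (lt_min hδ₀ hδJ) hδJ'0) (lt_min hδc hδD)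
  have hδm₀ : δm ≤ δ₀ := (min_le_left _ _).trans ((min_le_left _ _).trans (min_le_left _ _))
  have hδmJ : δm ≤ δJ := (min_le_left _ _).trans ((min_le_left _ _).trans (min_le_right _ _))
  have hδmJ' : δm ≤ δJ' := (min_le_left _ _).trans (min_le_right _ _)
  have hδmc : δm ≤ δc := (min_le_right _ _).trans (min_le_left _ _)
  have hδmD : δm ≤ δD := (min_le_right _ _).trans (min_le_right _ _)
  set αR : ℝ := min (min αJ αJ') (1 / 16) with hαR
  have hc1h : 0 ≤ B6.c1 d δm (1 / 2) := c1_nonneg d _ _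
  refine ⟨αR, B6.c1 d δm (1 / 2) * B6.c1 d δm (1 / 2) *
      (BJ' * (Mφ * Mφ' * κ) * Kc * (1 * κ) * (BG + BJ * αR) + BG * (cSF * κ) * Kc * (1 * κ) * (BG + BJ * αR) +
        BG * (Mφ * Mφ' * κ) * KD * (1 * κ) * (BG + BJ * αR) + BG * (Mφ * Mφ' * κ) * Kc * (cKF * κ) * (BG + BJ * αR) +
          BG * (Mφ * Mφ' * κ) * Kc * (1 * κ) * BJ), δm / 2,
    lt_min (lt_min hαJ hαJ'0) (by norm_num), by positivity, by linarith, ?_⟩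
  intro n η hη c₀ c₁ _ _ hc m _ U α hα0 hαle hU1 hUs hUw hUst εU hε0 hε1 hεr hlev hlev1 hRlev hposU hpos₁ M Rr H k hcU hc1 hcD
  have hαJ' : α ≤ αJ := hαle.trans ((min_le_left _ _).trans (min_le_left _ _))
  have hαJ'' : α ≤ αJ' := hαle.trans ((min_le_left _ _).trans (min_le_right _ _))
  have hα16 : α ≤ 1 / 16 := hαle.trans (min_le_right _ _)
  have hD := Hlad n η hη c₀ c₁ hc m U α hα0 hαJ' hU1 hUs hUw εU hε0 hε1 hεr hlev hlev1 hposU hpos₁ M Rr H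
  have hGD := Hgrad n η hη c₀ c₁ hc m U α hα0 hαJ'' hU1 hUs hUw εU hε0 hε1 hεr hlev hlev1 hposU hpos₁ M Rr H k
  rw [mul_sub] at hGD
  have hF := (hbase n η hη c₀ c₁ hc m hpos₁ M Rr H).1
  have hXF := (hbase n η hη c₀ c₁ hc m hpos₁ M Rr H).2.1 k
  have hlen1 : ∀ a : (towerGeom L m n η M).Site, (towerGeom L m n η M).len a = 1 := fun a => by
    rw [len_towerGeom, mul_comm]; exact hη
  have hdnn := hdnn_towerGeom L m n η M
  have hc₀ : (0 : ℝ) < c₀ := Fact.out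
  have hLp : ((L : ℝ) ^ (n + 1)) ^ d ≠ 0 := pow_ne_zero _ (pow_ne_zero _ (Nat.cast_ne_zero.mpr (NeZero.ne L)))
  have hw1 : (c₁ / c₀) * (((L : ℝ) ^ (n + 1)) ^ d)⁻¹ = 1 := by rw [← hc]; field_simp
  -- (1) the fine factors at the common rate
  have hF' : HasMajorant (g := toB6 (towerGeom L m n η M) Rr H) (fun p : TSite d (towerP L m (n + 1)) × ι => blkK L m n p.1) (conj b (readA φ (GpOfUk L m n φ η (fun _ : Bond d (towerP L m (n + 1)) => (1 : 𝔸ˣ)) a' (c₁ := c₁) hpos₁))) (fun a a'' => BG * Real.exp (-(δm * (towerGeom L m n η M).dist a a''))) :=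
    hasMajorant_mono _ hF fun a a'' => by
      rw [hlen1 a, one_pow, mul_one]
      exact weaken hBG.le le_rfl hδm₀ (hdnn a a'')
  have hEF' : HasMajorant (g := toB6 (towerGeom L m n η M) Rr H) (fun p : TSite d (towerP L m (n + 1)) × ι => blkK L m n p.1)
      (conj b (readA φ (GpOfUk L m n φ η U a' (c₁ := c₁) hposU)) - conj b (readA φ (GpOfUk L m n φ η (fun _ : Bond d (towerP L m (n + 1)) => (1 : 𝔸ˣ)) a' (c₁ := c₁) hpos₁)))
      (fun a a'' => BJ * α * Real.exp (-(δm * (towerGeom L m n η M).dist a a''))) :=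
    hasMajorant_mono _ hD fun a a'' => weaken (mul_nonneg hBJ hα0) le_rfl hδmJ (hdnn a a'')
  -- (1′) the FIRST pair: the flat gradient letter on `G′_k(1)` ((3.42)₂ at the vacuum) and on the difference (the gradient ladder)
  have hXF' : HasMajorant (g := toB6 (towerGeom L m n η M) Rr H) (fun p : TSite d (towerP L m (n + 1)) × ι => blkK L m n p.1)
      (conj b (diffLetter (fun μ => shiftEquiv (Pd := towerP L m (n + 1)) μ)
          (fun μ y => (fun _ : Bond d (towerP L m (n + 1)) => (1 : 𝔸ˣ)) (y, μ)) ((η : ℂ))⁻¹ k) *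
        conj b (readA φ (GpOfUk L m n φ η (fun _ : Bond d (towerP L m (n + 1)) => (1 : 𝔸ˣ)) a' (c₁ := c₁) hpos₁)))
      (fun a a'' => BG * Real.exp (-(δm * (towerGeom L m n η M).dist a a''))) :=
    hasMajorant_mono _ hXF fun a a'' => by
      rw [hlen1 a, mul_one]
      exact weaken hBG.le le_rfl hδm₀ (hdnn a a'')
  have hXEF' : HasMajorant (g := toB6 (towerGeom L m n η M) Rr H) (fun p : TSite d (towerP L m (n + 1)) × ι => blkK L m n p.1)
      (conj b (diffLetter (fun μ => shiftEquiv (Pd := towerP L m (n + 1)) μ)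
          (fun μ y => (fun _ : Bond d (towerP L m (n + 1)) => (1 : 𝔸ˣ)) (y, μ)) ((η : ℂ))⁻¹ k) *
          conj b (readA φ (GpOfUk L m n φ η U a' (c₁ := c₁) hposU)) -
        conj b (diffLetter (fun μ => shiftEquiv (Pd := towerP L m (n + 1)) μ)
          (fun μ y => (fun _ : Bond d (towerP L m (n + 1)) => (1 : 𝔸ˣ)) (y, μ)) ((η : ℂ))⁻¹ k) *
          conj b (readA φ (GpOfUk L m n φ η (fun _ : Bond d (towerP L m (n + 1)) => (1 : 𝔸ˣ)) a' (c₁ := c₁) hpos₁)))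
      (fun a a'' => BJ' * α * Real.exp (-(δm * (towerGeom L m n η M).dist a a''))) :=
    hasMajorant_mono _ hGD fun a a'' => weaken (mul_nonneg hBJ' hα0) le_rfl hδmJ' (hdnn a a'')
  -- (2) the coarse factors at the common rate
  have hcU' : HasMajorant (g := toB6 (towerGeom L m n η M) Rr H) (fun q : TSite d m × ι => q.1) (conj b (readA φ (greenK _ (QGGQk_pos L m n φ c₀ η U c₁ a' (adTransportW_adjoint φ τ hτ₂ hUst hφτ) hposU)))) (fun a a'' => Kc * Real.exp (-(δm * (towerGeom L m n η M).dist a a''))) :=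
    hasMajorant_mono _ hcU fun a a'' => weaken hKc le_rfl hδmc (hdnn a a'')
  have hc1' : HasMajorant (g := toB6 (towerGeom L m n η M) Rr H) (fun q : TSite d m × ι => q.1) (conj b (readA φ (greenK _ (QGGQk_pos L m n φ c₀ η (fun _ : Bond d (towerP L m (n + 1)) => (1 : 𝔸ˣ)) c₁ a' (adTransportW_adjoint φ τ hτ₂ (star_one_eq_inv_one L m n) hφτ) hpos₁)))) (fun a a'' => Kc * Real.exp (-(δm * (towerGeom L m n η M).dist a a''))) :=
    hasMajorant_mono _ hc1 fun a a'' => weaken hKc le_rfl hδmc (hdnn a a'')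
  have hcD' : HasMajorant (g := toB6 (towerGeom L m n η M) Rr H) (fun q : TSite d m × ι => q.1) (conj b (readA φ (greenK _ (QGGQk_pos L m n φ c₀ η U c₁ a' (adTransportW_adjoint φ τ hτ₂ hUst hφτ) hposU))) - conj b (readA φ (greenK _ (QGGQk_pos L m n φ c₀ η (fun _ : Bond d (towerP L m (n + 1)) => (1 : 𝔸ˣ)) c₁ a' (adTransportW_adjoint φ τ hτ₂ (star_one_eq_inv_one L m n) hφτ) hpos₁))))
      (fun a a'' => KD * α * Real.exp (-(δm * (towerGeom L m n η M).dist a a''))) :=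
    hasMajorant_mono _ hcD fun a a'' => weaken (mul_nonneg hKD hα0) le_rfl hδmD (hdnn a a'')
  -- (3) the block-diagonal letters (as in `B9Eq365TowerXOperatorLadder`)
  have hkF : ∀ y x, blkK L m n x = y →
      ‖((kQ L m n (fun j => adTransport (𝕜 := ℂ) (UlevOf L m (n + 1) U j))) - kQ L m n (fun _ _ => (LinearMap.id : 𝔸 →ₗ[ℂ] 𝔸))) y x‖ ≤ cKF * α * (((L : ℝ) ^ (n + 1)) ^ d)⁻¹ := fun y x _ => by
    refine (norm_kF_le_of_class L m n U εU hε0 hε1 hlev hlev1 hr0 hr1 hα0 hεr y x).trans ?_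
    have e1 : ((d * (L - 1) : ℕ) : ℝ) * (3 * α / (1 - r)) = ck * α := by rw [hck]; ring
    rw [e1, hcKF]
    exact mul_le_mul_of_nonneg_right (exp_window_sub_one_le hck0 hα0 hα16) (by positivity)
  have hker : conjHom b (kerOp (blkK L m n) (kQ L m n (fun j => adTransport (𝕜 := ℂ) (UlevOf L m (n + 1) U j)))) - conjHom b (kerOp (blkK L m n) (kQ L m n (fun j => adTransport (𝕜 := ℂ) (UlevOf L m (n + 1) (fun _ : Bond d (towerP L m (n + 1)) => (1 : 𝔸ˣ)) j)))) =
      conjHom b (kerOp (blkK L m n) ((kQ L m n (fun j => adTransport (𝕜 := ℂ) (UlevOf L m (n + 1) U j))) - kQ L m n (fun _ _ => (LinearMap.id : 𝔸 →ₗ[ℂ] 𝔸)))) := by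
    rw [← conjHom_sub, kQ_flatLevels_eq]
    refine congrArg (conjHom b) (LinearMap.ext fun μ => ?_)
    rw [LinearMap.sub_apply, sub_eq_iff_eq_add, ← kerOp_add_kernel, sub_add_cancel]
  have hA : HasMajorantHom (g := toB6 (towerGeom L m n η M) Rr H) (fun p : TSite d (towerP L m (n + 1)) × ι => blkK L m n p.1) (fun q : TSite d m × ι => q.1)
      (conjHom b (kerOp (blkK L m n) (kQ L m n (fun j => adTransport (𝕜 := ℂ) (UlevOf L m (n + 1) U j)))) - conjHom b (kerOp (blkK L m n) (kQ L m n (fun j => adTransport (𝕜 := ℂ) (UlevOf L m (n + 1) (fun _ : Bond d (towerP L m (n + 1)) => (1 : 𝔸ˣ)) j)))))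
      (fun a a'' : TSite d m => if a = a'' then cKF * κ * α else 0) := by
    rw [hker]
    exact hasMajorantHom_mono _ _ (hasMajorantHom_kerOp_ind L m n η M b hM₂ hrepr Rr H _ (mul_nonneg hcKF0 hα0) hkF)
      fun a a'' => le_of_eq (by split_ifs <;> ring)
  have hAU : HasMajorantHom (g := toB6 (towerGeom L m n η M) Rr H) (fun p : TSite d (towerP L m (n + 1)) × ι => blkK L m n p.1) (fun q : TSite d m × ι => q.1) (conjHom b (kerOp (blkK L m n) (kQ L m n (fun j => adTransport (𝕜 := ℂ) (UlevOf L m (n + 1) U j))))) (fun a a'' : TSite d m => if a = a'' then 1 * κ else 0) :=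
    hasMajorantHom_kerOp_ind L m n η M b hM₂ hrepr Rr H _ zero_le_one fun y x _ => by
      rw [one_mul]
      exact norm_kQ_le L m n _ (fun j bd v => B9Eq357QprimeTowerKernelForm.norm_adTransport_le_of_norm_le_one _
        (fun bd' => (B7Prop1Explicit.mem_U1).1 (hlev1 j bd')) bd v) y x
  have hA1 : HasMajorantHom (g := toB6 (towerGeom L m n η M) Rr H) (fun p : TSite d (towerP L m (n + 1)) × ι => blkK L m n p.1) (fun q : TSite d m × ι => q.1) (conjHom b (kerOp (blkK L m n) (kQ L m n (fun j => adTransport (𝕜 := ℂ) (UlevOf L m (n + 1) (fun _ : Bond d (towerP L m (n + 1)) => (1 : 𝔸ˣ)) j))))) (fun a a'' : TSite d m => if a = a'' then 1 * κ else 0) := by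
    rw [kQ_flatLevels_eq]
    exact hasMajorantHom_kerOp_ind L m n η M b hM₂ hrepr Rr H _ zero_le_one fun y x _ => by
      rw [one_mul]; exact norm_kQ_le L m n _ (fun _ _ v => le_rfl) y x
  have hsU : ∀ x, ‖(sQ L m n φ U (c₀ := c₀) (c₁ := c₁)) x‖ ≤ Mφ * Mφ' := fun x =>
    (norm_sQ_le L m n φ (c₀ := c₀) (c₁ := c₁) U hMφ hMφ' hφn hφn' hRlev x).trans (le_of_eq (by rw [hw1, mul_one]))
  have hs1 : ∀ x, ‖(sQ L m n φ (fun _ : Bond d (towerP L m (n + 1)) => (1 : 𝔸ˣ)) (c₀ := c₀) (c₁ := c₁)) x‖ ≤ Mφ * Mφ' := fun x =>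
    (norm_sQ_le L m n φ (c₀ := c₀) (c₁ := c₁) (fun _ : Bond d (towerP L m (n + 1)) => (1 : 𝔸ˣ)) hMφ hMφ' hφn hφn' (norm_adTransportW_UlevOf_one_le L m n φ) x).trans (le_of_eq (by rw [hw1, mul_one]))
  have hSU : HasMajorantHom (g := toB6 (towerGeom L m n η M) Rr H) (fun q : TSite d m × ι => q.1) (fun p : TSite d (towerP L m (n + 1)) × ι => blkK L m n p.1) (conjHom b (liftOp (blkK L m n) (sQ L m n φ U (c₀ := c₀) (c₁ := c₁)))) (fun a a'' : TSite d m => if a = a'' then Mφ * Mφ' * κ else 0) :=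
    hasMajorantHom_liftOp_ind L m n η M b hM₂ hrepr Rr H _ (mul_nonneg hMφ hMφ') hsU
  have hS1 : HasMajorantHom (g := toB6 (towerGeom L m n η M) Rr H) (fun q : TSite d m × ι => q.1) (fun p : TSite d (towerP L m (n + 1)) × ι => blkK L m n p.1) (conjHom b (liftOp (blkK L m n) (sQ L m n φ (fun _ : Bond d (towerP L m (n + 1)) => (1 : 𝔸ˣ)) (c₀ := c₀) (c₁ := c₁)))) (fun a a'' : TSite d m => if a = a'' then Mφ * Mφ' * κ else 0) :=
    hasMajorantHom_liftOp_ind L m n η M b hM₂ hrepr Rr H _ (mul_nonneg hMφ hMφ') hs1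
  have hsF : ∀ x, ‖((sQ L m n φ U (c₀ := c₀) (c₁ := c₁)) - (sQ L m n φ (fun _ : Bond d (towerP L m (n + 1)) => (1 : 𝔸ˣ)) (c₀ := c₀) (c₁ := c₁))) x‖ ≤ cSF * α := fun x => by
    rw [Pi.sub_apply]
    refine (norm_sF_le_of_class L m n φ U εU hε0 hlev hlev1 hr0 hr1 hα0 hεr hMφ hMφ' hφn hφn' x).trans ?_
    have e1 : ((d * (L - 1) : ℕ) : ℝ) * (2 * Mφ * Mφ' * α / (1 - r)) = cs * α := by rw [hcs]; ring
    rw [e1]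
    have hexp := exp_window_sub_one_le hcs0 hα0 hα16
    calc Mφ * Mφ' * ((c₁ / c₀) * ((Real.exp (cs * α) - 1) * (((L : ℝ) ^ (n + 1)) ^ d)⁻¹))
          = Mφ * Mφ' * (Real.exp (cs * α) - 1) * ((c₁ / c₀) * (((L : ℝ) ^ (n + 1)) ^ d)⁻¹) := by ring
      _ = Mφ * Mφ' * (Real.exp (cs * α) - 1) := by rw [hw1, mul_one]
      _ ≤ Mφ * Mφ' * (cs * Real.exp (cs * (1 / 16)) * α) := mul_le_mul_of_nonneg_left hexp (mul_nonneg hMφ hMφ')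
      _ = cSF * α := by rw [hcSF]; ring
  have hlift : conjHom b (liftOp (blkK L m n) (sQ L m n φ U (c₀ := c₀) (c₁ := c₁))) - conjHom b (liftOp (blkK L m n) (sQ L m n φ (fun _ : Bond d (towerP L m (n + 1)) => (1 : 𝔸ˣ)) (c₀ := c₀) (c₁ := c₁))) =
      conjHom b (liftOp (blkK L m n) ((sQ L m n φ U (c₀ := c₀) (c₁ := c₁)) - (sQ L m n φ (fun _ : Bond d (towerP L m (n + 1)) => (1 : 𝔸ˣ)) (c₀ := c₀) (c₁ := c₁)))) := by
    rw [← conjHom_sub]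
    refine congrArg (conjHom b) (LinearMap.ext fun ν => funext fun x => ?_)
    rw [LinearMap.sub_apply, Pi.sub_apply, liftOp_apply, liftOp_apply, liftOp_apply, Pi.sub_apply, sub_apply]
  have hS : HasMajorantHom (g := toB6 (towerGeom L m n η M) Rr H) (fun q : TSite d m × ι => q.1) (fun p : TSite d (towerP L m (n + 1)) × ι => blkK L m n p.1)
      (conjHom b (liftOp (blkK L m n) (sQ L m n φ U (c₀ := c₀) (c₁ := c₁))) - conjHom b (liftOp (blkK L m n) (sQ L m n φ (fun _ : Bond d (towerP L m (n + 1)) => (1 : 𝔸ˣ)) (c₀ := c₀) (c₁ := c₁))))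
      (fun a a'' : TSite d m => if a = a'' then cSF * κ * α else 0) := by
    rw [hlift]
    exact hasMajorantHom_mono _ _ (hasMajorantHom_liftOp_ind L m n η M b hM₂ hrepr Rr H _ (mul_nonneg hcSF0 hα0) hsF)
      fun a a'' => le_of_eq (by split_ifs <;> ring)
  -- (4) the words and the abstract ladder
  rw [conj_readA_RofUk_eq L m n φ η U a' (adTransportW_adjoint φ τ hτ₂ hUst hφτ) hposU b, conj_readA_RofUk_eq L m n φ η (fun _ : Bond d (towerP L m (n + 1)) => (1 : 𝔸ˣ)) a' (adTransportW_adjoint φ τ hτ₂ (star_one_eq_inv_one L m n) hφτ) hpos₁ b, sub_sub_sub_cancel_left,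
    mul_sub, mul_comp_eq, mul_comp_eq]
  have hW := hasMajorant_word5_sub_word5_first L m n η M Rr H (fun p : TSite d (towerP L m (n + 1)) × ι => blkK L m n p.1) (fun q : TSite d m × ι => q.1) hBG.le hBJ' hBG.le hBJ (by positivity)
    (mul_nonneg hcSF0 hκ0) hKc hKD (by positivity) (mul_nonneg hcKF0 hκ0) hα0 hαle hδm0 hXF' hXEF' hF' hEF' hSU hS1 hS hcU' hc1' hcD' hAU hA1 hA
  have hW' := hasMajorant_neg (g := toB6 (towerGeom L m n η M) Rr H) _ hW
  rw [neg_sub] at hW'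
  refine hasMajorant_mono _ hW' fun a a'' => le_of_eq ?_
  ring

end Main


/-! ## §3 The gradient ladder for `R_k` with the `c_k` data discharged -/

section Closed


variable {d : ℕ} (L : ℕ) [NeZero L] {𝔸 : Type*} [NormedRing 𝔸] [NormedAlgebra ℂ 𝔸] [CompleteSpace 𝔸] [NormOneClass 𝔸] [StarRing 𝔸] [NormedStarGroup 𝔸] [StarModule ℂ 𝔸]
  [FiniteDimensional ℂ 𝔸]
  {W : Type*} [NormedAddCommGroup W] [InnerProductSpace ℂ W] [FiniteDimensional ℂ W] (φ : W ≃ₗ[ℂ] 𝔸) {a a' Mφ Mφ' : ℝ}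
  (hMφ : 0 ≤ Mφ) (hMφ' : 0 ≤ Mφ') (hφn : ∀ w, ‖φ w‖ ≤ Mφ * ‖w‖) (hφn' : ∀ X, ‖φ.symm X‖ ≤ Mφ' * ‖X‖) (ha : 0 < a) (ha' : 0 < a')
  {r : ℝ} (hr0 : 0 ≤ r) (hr1 : r < 1)
  (τ : 𝔸 →ₗ[ℂ] ℂ) {Cτ : ℝ} (hτ : ∀ X, ‖τ X‖ ≤ Cτ * ‖X‖) (hCτ : 0 ≤ Cτ) {ρw : ℝ} (hρw : 0 ≤ ρw)
  (hτ₁ : ∀ X : 𝔸, τ (star X) = starRingEnd ℂ (τ X)) (hτ₂ : ∀ X Y : 𝔸, τ (X * Y) = τ (Y * X)) (hφτ : ∀ X Y : 𝔸, ⟪φ.symm X, φ.symm Y⟫_ℂ = τ (star X * Y))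
  {Mτ : ℝ} (hMτ : 0 ≤ Mτ)
  {ι : Type} [Fintype ι] [DecidableEq ι] (b : Module.Basis ι ℝ 𝔸) {M₂ : ℝ} (hM₂ : 0 ≤ M₂) (hrepr : ∀ (v : 𝔸) (i : ι), |b.repr v i| ≤ M₂ * ‖v‖)

include hMφ hMφ' hφn hφn' ha ha' hr0 hr1 hτ hCτ hρw hτ₁ hτ₂ hφτ hMτ hM₂ hrepr in
/-- **THE TWO-BACKGROUND LADDER FOR THE GRADIENT ROW OF `R_k`, ROWS CLOSED** — §2 with the inverse third operator's rows supplied by the OWNER's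
`B9Eq326WoodburyLettersTower.exists_local_letter_QGGQInvk_closed` (through `B9Eq349TowerSiteRowSeam`) and its ladder by `B9Eq367TowerQGGQInvLadderClosed`, exactly as in
`B9Eq368TowerProjLadderClosed`: on print's small-field class of the MODEL letters, for every flat direction letter `k`,
`conj b (∇^η_{1,k}) * (conj b (readA φ R_k(U)) − conj b (readA φ R_k(1))) ≺ K·α·e^{−δ d}` over `towerGeom`, `α_R, K, δ` BEFORE `n, η, m, U`.
[cite: Balaban1985BackgroundPropagators, (3.68) p.403, (3.25) p.394, Thm 3.1 (3.42) p.397, Thm 3.2 (3.48) p.398, Thm 3.11 p.416; Balaban1984PropagatorsII, (2.51)–(2.55) p.232, (2.66) p.234] -/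
theorem exists_hasMajorant_diffLetter_RofUk_sub_flat_closed (hd : 1 ≤ d) (hL : 1 ≤ L) (hL3 : 3 ≤ L) :
    ∃ αR K δ : ℝ, 0 < αR ∧ 0 ≤ K ∧ 0 < δ ∧
      ∀ (n : ℕ) (η : ℝ), η * (L : ℝ) ^ (n + 1) = 1 →
      ∀ (c₀ c₁ : ℝ) [Fact (0 < c₀)] [Fact (0 < c₁)], c₀ * ((L : ℝ) ^ (n + 1)) ^ d = c₁ → |η| ^ d / c₀ ≤ ρw →
      ∀ (m : Fin d → ℕ) [∀ i, NeZero (m i)], (∀ i, 1 ≤ m i) → ∀ (U : Bond d (towerP L m (n + 1)) → 𝔸ˣ) (α : ℝ), 0 ≤ α → α ≤ αR →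
        (∀ bd, U bd ∈ U1 𝔸) → (∀ bd, ‖(U bd : 𝔸) - 1‖ ≤ α * η) →
        (∀ (x : TSite d (towerP L m (n + 1))) (μ ν : Fin d), ‖(U (shift ν x, μ) : 𝔸) - (U (x, μ) : 𝔸)‖ ≤ α * η ^ 2) →
        (∀ p : B9SectCLatticeCarrier.Plaq d (towerP L m (n + 1)), ‖(plaqHolU U p : 𝔸) - 1‖ ≤ α * η ^ 2) →
      ∀ (hUst : ∀ bd, star (U bd : 𝔸) = (((U bd)⁻¹ : 𝔸ˣ) : 𝔸))
        (αU : ℕ → ℝ), (∀ j, αU j ≤ 1 / 64) →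
        (∀ (j : ℕ) (x : B7Prop1Explicit.Site d) (k : Fin d), perCfg (towerP L m (j + 1)) (UlevOf L m (n + 1) U j) x k ∈ U1 𝔸) →
        (∀ (j : ℕ) (y : TSite d (towerP L m j)) (k : Fin d) (ρ' : Fin d → Fin L),
          ‖((Wcx L (perCfg (towerP L m (j + 1)) (UlevOf L m (n + 1) U j)) (cornerSite L y) k (boxVec L ρ') : 𝔸ˣ) : 𝔸) - 1‖ ≤ αU j) →
      ∀ (εU : ℕ → ℝ), (∀ j, 0 ≤ εU j) → (∀ j, εU j ≤ 1) → (∀ j < n + 1, εU j ≤ α * r ^ j) →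
        (∀ (j : ℕ) (bd : Bond d (towerP L m (j + 1))), ‖(UlevOf L m (n + 1) U j bd : 𝔸) - 1‖ ≤ εU j) →
        (∀ (j : ℕ) (bd : Bond d (towerP L m (j + 1))), UlevOf L m (n + 1) U j bd ∈ U1 𝔸) →
        (∀ (j : ℕ) (bd : Bond d (towerP L m (j + 1))) (w : W), ‖adTransportW φ (UlevOf L m (n + 1) U j) bd w‖ ≤ ‖w‖) →
      ∀ (hposU : ∀ x : SiteL2K ℂ d (towerP L m (n + 1)) c₀ W, x ≠ 0 → 0 < RCLike.re ⟪x, laplacePrimeAk L m n φ η U a' (c₁ := c₁) x⟫_ℂ)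
        (hpos₁ : ∀ x : SiteL2K ℂ d (towerP L m (n + 1)) c₀ W, x ≠ 0 →
          0 < RCLike.re ⟪x, laplacePrimeAk L m n φ η (fun _ : Bond d (towerP L m (n + 1)) => (1 : 𝔸ˣ)) a' (c₁ := c₁) x⟫_ℂ)
        (rr : TSite d m → SiteL2K ℂ d m c₁ W →L[ℂ] SiteL2K ℂ d m c₁ W),
        (∀ (y : TSite d m) (g : SiteL2K ℂ d m c₁ W) (y' : TSite d m),
          WL2.equiv ℂ (fun _ : TSite d m => c₁) W (rr y g) y' = if y' = y then WL2.equiv ℂ (fun _ : TSite d m => c₁) W g y' else 0) →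
      ∀ (M Rr : ℝ) (H : Prop) (k : Fin d ⊕ Fin d),
      HasMajorant (g := toB6 (towerGeom L m n η M) Rr H) (fun p : TSite d (towerP L m (n + 1)) × ι => blkK L m n p.1)
        (conj b (diffLetter (fun μ => shiftEquiv (Pd := towerP L m (n + 1)) μ)
            (fun μ y => (fun _ : Bond d (towerP L m (n + 1)) => (1 : 𝔸ˣ)) (y, μ)) ((η : ℂ))⁻¹ k) *
          (conj b (readA φ (RofUk L m n φ η U (c₀ := c₀))) - conj b (readA φ (RofUk L m n φ η (fun _ : Bond d (towerP L m (n + 1)) => (1 : 𝔸ˣ)) (c₀ := c₀)))))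
        (fun a a'' => K * α * Real.exp (-(δ * (towerGeom L m n η M).dist a a''))) := by
  obtain ⟨α₁, C, ρ, hα₁, hC, hρ, ROW⟩ :=
    exists_local_letter_QGGQInvk_closed hd L hL hL3 φ hMφ hMφ' hφn hφn' ha ha' hr0 hr1 τ hτ hCτ hρw hτ₁ hτ₂ hφτ hMτ
  have hSb : 0 ≤ ∑ i, ‖b i‖ := Finset.sum_nonneg fun i _ => norm_nonneg _
  have hKc : 0 ≤ M₂ * (∑ i, ‖b i‖) * (Mφ * Mφ') * C := by positivity
  have hδc : 0 < ρ / d := div_pos hρ (by exact_mod_cast hd)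
  obtain ⟨αX, KX, δX, hαX, hKX, hδX, HC⟩ :=
    exists_hasMajorant_greenK_QGGQk_sub_flat L φ hMφ hMφ' hφn hφn' ha ha' hr0 hr1 τ hτ hCτ hρw hτ₁ hτ₂ hφτ hMτ b hM₂ hrepr hd hL hL3
  obtain ⟨αR, K, δ, hαR, hK, hδ, HR⟩ :=
    exists_hasMajorant_diffLetter_RofUk_sub_flat L φ hMφ hMφ' hφn hφn' ha' hr0 hr1 τ hτ₂ hφτ b hM₂ hrepr hd hL3 hKc hδc hKX hδX
  refine ⟨min (min α₁ αX) αR, K, δ, lt_min (lt_min hα₁ hαX) hαR, hK, hδ, ?_⟩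
  intro n η hη c₀ c₁ _ _ hc hρη m _ hm U α hα0 hαle hU1 hUs hUw hpl hUst αU hα1 hU1p hreg εU hε0 hε1 hεr hlev hlev1 hRlev hposU hpos₁ rr hrr M Rr H k
  have hα₁' : α ≤ α₁ := hαle.trans ((min_le_left _ _).trans (min_le_left _ _))
  have hαX' : α ≤ αX := hαle.trans ((min_le_left _ _).trans (min_le_right _ _))
  have hαR' : α ≤ αR := hαle.trans (min_le_right _ _)
  have hη0 : 0 ≤ η := by
    have hLp : (0 : ℝ) < (L : ℝ) ^ (n + 1) := by
      have : (0 : ℝ) < (L : ℝ) := by exact_mod_cast (Nat.pos_of_ne_zero (NeZero.ne L))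
      positivity
    nlinarith
  have hrowU := hasMajorant_conj_readA_of_siteRow_tdist L m n η M Rr H φ hMφ hMφ' hφn hφn' b hM₂ hrepr hd
    (greenK _ (QGGQk_pos L m n φ c₀ η U c₁ a' (adTransportW_adjoint φ τ hτ₂ hUst hφτ) hposU)) hC hρ.le
    (fun v g F hgv hgF x => ROW n η hη c₀ c₁ hc hρη m hm U αU hα1 hU1p hreg εU hε0 hlev hlev1 α hα0 hα₁' hUst hU1 hUs hpl hεr hposU rr hrr v g F hgv hgF x)
  have hrow1 := hasMajorant_conj_readA_of_siteRow_tdist L m n η M Rr H φ hMφ hMφ' hφn hφn' b hM₂ hrepr hd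
    (greenK _ (QGGQk_pos L m n φ c₀ η (fun _ : Bond d (towerP L m (n + 1)) => (1 : 𝔸ˣ)) c₁ a' (adTransportW_adjoint φ τ hτ₂ (star_one_eq_inv_one L m n) hφτ) hpos₁)) hC hρ.le
    (fun v g F hgv hgF x => ROW n η hη c₀ c₁ hc hρη m hm (fun _ : Bond d (towerP L m (n + 1)) => (1 : 𝔸ˣ)) (fun _ => 0) (fun _ => by norm_num)
      (perCfg_UlevOf_one_mem_U1 L m (n + 1)) (norm_Wcx_UlevOf_one_sub_one_le L m (n + 1) (fun _ => 0) (fun _ => le_rfl))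
      (fun _ => 0) (fun _ => le_rfl) (UlevOf_one_norm_sub_one_le L m n) (UlevOf_one_mem_U1 L m n) α hα0 hα₁' (star_one_eq_inv_one L m n)
      (fun _ => one_mem _) (fun _ => by simp only [Units.val_one, sub_self, norm_zero]; positivity)
      (fun _ => by simp only [plaqHolU_one, Units.val_one, sub_self, norm_zero]; positivity) (fun _ _ => by positivity) hpos₁ rr hrr v g F hgv hgF x)
  have hcD := HC n η hη c₀ c₁ hc hρη m hm U α hα0 hαX' hU1 hUs hUw hpl hUst αU hα1 hU1p hreg εU hε0 hε1 hεr hlev hlev1 hRlev hposU hpos₁ rr hrr M Rr H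
  exact HR n η hη c₀ c₁ hc m U α hα0 hαR' hU1 hUs hUw hUst εU hε0 hε1 hεr hlev hlev1 hRlev hposU hpos₁ M Rr H k hrowU hrow1 hcD

end Closed

end Literature.MathematicalPhysics.QuantumFieldTheory.Balaban1983to89.B9Eq368TowerProjGradientLadder

end
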